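import Mathlib
import Literature.Analysis.FluidPDE.SuitableWeak
import Literature.Analysis.FluidPDE.SpaceTimeRescaling
import Literature.Analysis.FunctionSpaces.SobolevDomainProofs
import Summits.NavierStokesRegularity.NavierStokesRegularity.Theorems.EulerZoomLiouvillePowerGaugeEulerLiouvillePastFrameSteadyConfined
import Summits.NavierStokesRegularity.NavierStokesRegularity.Theorems.EulerZoomLiouvillePowerGaugeEulerLiouvilleBackwardTools
import Summits.NavierStokesRegularity.NavierStokesRegularity.Theorems.EulerZoomLiouvillePowerGaugeEulerLiouvilleSelfSimilarBoundedRigidity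
import Summits.NavierStokesRegularity.NavierStokesRegularity.Theorems.EulerZoomLiouvillePowerGaugeEulerLiouvilleSelfSimilarPastExtension
import Summits.NavierStokesRegularity.NavierStokesRegularity.Theorems.TerminalTraceTypeITraceScarL3NoConcentration
import HarnessLib

/-!
# FRAME-STEADY TOOLS: the profile is measurable, the uniform background is constant
# (line `galilean-frames`, stub F1 `stub_frameSteady`, step (i) of the card; crux = stmt-NavierStokesRegularity-19832)

Route `EulerZoomLiouville` (NavierStokesRegularity); width seat ns-ezl-w6 g2 (LEAD ns-typeII-p2 g12; line `galilean-frames` of ns-idea-11 g6, 2026-08-28).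
For a frame-steady past member `u(τ, ·) = U(· − ξ(τ)) + η(τ)` (`τ < T₁ ≤ 0`) of Seregin's power-gauged class: the profile `U` is a.e.-strongly measurable
(one good slice is locally integrable, `FrameSteady.ae_hasWeakFDerivOn_slice_past`), hence every slice is; and THE UNIFORM BACKGROUND IS CONSTANT
(`FrameSteady.background_eq_of_gaugeA`, `ρ > −1`): `η(τ₂) − η(τ₁) = u(τ₂) − u(τ₁)(· + ξ(τ₁) − ξ(τ₂))` is a constant whose `L²`-mass on `B_L` is
`≤ 32 c L^{1−2ρ}` by the slice `A`-gauge on both slices (`Backward.lintegral_ball_le_of_gaugeA`), so it vanishes (`Shifted.growth_of_growth_le`,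
`NoDrift.eq_zero_of_const_of_lintegral_ball_le`).  Hence `u(τ) = Ũ(· − ξ(τ))` with ONE measurable profile and NO background
(`FrameSteady.exists_profile_noBackground`) — the normal form from which the card's levers L1/L2 start for the fast-frame residue of F1.
WHAT THIS IS NOT: not NS, not E — tools for a stratum of the crux CLASS on the MODEL lattice (`--supports` stmt-19832); 19832 OPEN. [folklore]
-/

noncomputable section

set_option linter.dupNamespace false -- flat `Theorems/<Route><Decl>…` files share the crux namespace `Summit.<S>.<S>.…`

open MeasureTheory Set Filter Topology Metric Function TopologicalSpace
open scoped ENNReal NNReal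

namespace Summit.NavierStokesRegularity.NavierStokesRegularity.Theorems.PowerGaugeEulerLiouville

open Literature.Analysis Literature.Analysis.FunctionSpaces Literature.Analysis.FluidPDE

namespace FrameSteady

variable {u : ℝ → EuclideanSpace ℝ (Fin 3) → EuclideanSpace ℝ (Fin 3)}
  {H : ℝ → EuclideanSpace ℝ (Fin 3) → EuclideanSpace ℝ (Fin 3) →L[ℝ] EuclideanSpace ℝ (Fin 3)}
  {T₁ : ℝ} {U : EuclideanSpace ℝ (Fin 3) → EuclideanSpace ℝ (Fin 3)} {ξ η : ℝ → EuclideanSpace ℝ (Fin 3)}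

/-! ## The profile of a frame-steady past member is measurable -/

/-- **The profile is a.e.-strongly measurable**: one good slice `u(τ₀) = U(· − ξ(τ₀)) + η(τ₀)` is locally integrable
(`ae_hasWeakFDerivOn_slice_past`), and `U = u(τ₀)(· + ξ(τ₀)) − η(τ₀)`. [folklore] -/
theorem aestronglyMeasurable_profile
    (hH : HasWeakSpatialGradientOn (slab (EuclideanSpace ℝ (Fin 3)) (Iio 0) isOpen_Iio) u H) (hT₁ : T₁ ≤ 0)
    (hu : ∀ τ : ℝ, τ < T₁ → u τ = fun y => U (y - ξ τ) + η τ) :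
    AEStronglyMeasurable U volume := by
  have hne : (ae (volume.restrict (Iio T₁))).NeBot := by
    rw [ae_neBot, Ne, Measure.restrict_eq_zero, Real.volume_Iio]; exact ENNReal.top_ne_zero
  obtain ⟨τ₀, hτ₀, hτ₀T⟩ := ((ae_hasWeakFDerivOn_slice_past hH hT₁).and (ae_restrict_mem measurableSet_Iio)).exists
  have h1 : AEStronglyMeasurable (u τ₀) volume := by
    have := hτ₀.locallyIntegrableOn.aestronglyMeasurable
    rwa [Opens.coe_top, Measure.restrict_univ] at this
  have h2 : AEStronglyMeasurable (fun y => u τ₀ (y + ξ τ₀)) volume :=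
    h1.comp_quasiMeasurePreserving (measurePreserving_add_right volume (ξ τ₀)).quasiMeasurePreserving
  have e : U = fun y => u τ₀ (y + ξ τ₀) - η τ₀ := by
    funext y; rw [hu τ₀ hτ₀T]; simp
  rw [e]
  exact h2.sub aestronglyMeasurable_const

/-- **Every slice of a frame-steady past member is a.e.-strongly measurable.** [folklore] -/
theorem aestronglyMeasurable_slice
    (hH : HasWeakSpatialGradientOn (slab (EuclideanSpace ℝ (Fin 3)) (Iio 0) isOpen_Iio) u H) (hT₁ : T₁ ≤ 0)
    (hu : ∀ τ : ℝ, τ < T₁ → u τ = fun y => U (y - ξ τ) + η τ) {τ : ℝ} (hτ : τ < T₁) :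
    AEStronglyMeasurable (u τ) volume := by
  rw [hu τ hτ]
  exact ((aestronglyMeasurable_profile hH hT₁ hu).comp_quasiMeasurePreserving
    (measurePreserving_sub_right volume (ξ τ)).quasiMeasurePreserving).add aestronglyMeasurable_const

/-! ## The uniform background is constant (the two-slice `A`-gauge comparison) -/

/-- **Translating a ball integral**: if `‖x‖ ≤ L` then `∫_{B_L} g(· + x) ≤ ∫_{B_{2L}} g`. [folklore] -/
theorem setLIntegral_ball_translate_le (g : EuclideanSpace ℝ (Fin 3) → ℝ≥0∞) {L : ℝ} {x : EuclideanSpace ℝ (Fin 3)} (hx : ‖x‖ ≤ L) :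
    ∫⁻ y in ball (0 : EuclideanSpace ℝ (Fin 3)) L, g (y + x) ≤ ∫⁻ y in ball (0 : EuclideanSpace ℝ (Fin 3)) (2 * L), g y := by
  have hpre : (fun y : EuclideanSpace ℝ (Fin 3) => x + (1 : ℝ) • y) ⁻¹' ball x L = ball 0 L := by
    rw [space_affine_preimage_ball one_pos]; simp
  have h1 : ∫⁻ y in ball (0 : EuclideanSpace ℝ (Fin 3)) L, g (y + x) = ∫⁻ y in ball x L, g y := by
    have e : (fun y : EuclideanSpace ℝ (Fin 3) => g (y + x)) = fun y => g (x + (1 : ℝ) • y) := by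
      funext y; rw [one_smul, add_comm]
    rw [e, ← hpre, setLIntegral_preimage_comp_space_affine one_pos x g (ball x L), finrank_euclideanSpace_fin, one_pow,
      inv_one, ENNReal.ofReal_one, one_mul]
  rw [h1]
  refine lintegral_mono_set fun y hy => ?_
  rw [mem_ball, dist_eq_norm] at hy ⊢
  have : ‖y‖ ≤ ‖y - x‖ + ‖x‖ := by
    have := norm_add_le (y - x) x; rwa [sub_add_cancel] at this
  rw [sub_zero]
  linarith

/-- **THE UNIFORM BACKGROUND OF A FRAME-STEADY PAST MEMBER IS CONSTANT** (card F1, step (i); `ρ > −1`): for `τ₁, τ₂ < T₁` the constant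
`η(τ₂) − η(τ₁) = u(τ₂) − u(τ₁)(· + ξ(τ₁) − ξ(τ₂))` has `L²`-mass `≤ 32c L^{1−2ρ}` on the balls `B_L`, `L` large (slice `A`-gauge on both slices,
`Backward.lintegral_ball_le_of_gaugeA`), so it vanishes (`Shifted.growth_of_growth_le`, `NoDrift.eq_zero_of_const_of_lintegral_ball_le`). [folklore] -/
theorem background_eq_of_gaugeA
    (hH : HasWeakSpatialGradientOn (slab (EuclideanSpace ℝ (Fin 3)) (Iio 0) isOpen_Iio) u H) (hT₁ : T₁ ≤ 0)
    (hu : ∀ τ : ℝ, τ < T₁ → u τ = fun y => U (y - ξ τ) + η τ)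
    {ρ : ℝ} (hρ : -1 < ρ) {c : ℝ≥0}
    (hA : ∀ a : ℝ, 0 < a → ENNReal.ofReal (a ^ (2 * ρ)) * cknA a (0 : ℝ × EuclideanSpace ℝ (Fin 3)) u ≤ (c : ℝ≥0∞))
    {τ₁ τ₂ : ℝ} (hτ₁ : τ₁ < T₁) (hτ₂ : τ₂ < T₁) : η τ₁ = η τ₂ := by
  set δ : EuclideanSpace ℝ (Fin 3) := ξ τ₁ - ξ τ₂ with hδ
  set w : EuclideanSpace ℝ (Fin 3) := η τ₂ - η τ₁ with hw
  -- `w = u τ₂ y − u τ₁ (y + δ)` for every `y`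
  have hwy : ∀ y, w = u τ₂ y - u τ₁ (y + δ) := fun y => by
    rw [hu τ₂ hτ₂, hu τ₁ hτ₁]
    simp only [hδ, hw]
    rw [show y + (ξ τ₁ - ξ τ₂) - ξ τ₁ = y - ξ τ₂ by abel]
    abel
  have hm₁ : AEStronglyMeasurable (fun y => u τ₁ (y + δ)) volume :=
    (aestronglyMeasurable_slice hH hT₁ hu hτ₁).comp_quasiMeasurePreserving (measurePreserving_add_right volume δ).quasiMeasurePreserving
  -- the growth bound on large balls
  set L₀ : ℝ := |τ₁| + |τ₂| + 2 * ‖δ‖ + 2 with hL₀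
  have hL₀1 : 1 ≤ L₀ := by rw [hL₀]; linarith [abs_nonneg τ₁, abs_nonneg τ₂, norm_nonneg δ]
  have hgrow : ∀ L : ℝ, L₀ ≤ L → ∫⁻ y in ball (0 : EuclideanSpace ℝ (Fin 3)) L, ‖(fun _ : EuclideanSpace ℝ (Fin 3) => w) y‖ₑ ^ 2 ≤
      (32 * (c : ℝ≥0∞)) * ENNReal.ofReal (L ^ (1 - 2 * ρ)) := by
    intro L hL
    have hL1 : 1 ≤ L := hL₀1.trans hL
    have hL0 : 0 < L := by linarith
    have h2L : 0 < 2 * L := by linarith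
    have hLL : L ≤ (2 * L) ^ 2 := by nlinarith
    have hτ₁I : τ₁ ∈ Ioo (-((2 * L) ^ 2)) 0 :=
      ⟨by linarith [neg_abs_le τ₁, abs_nonneg τ₂, norm_nonneg δ], lt_of_lt_of_le hτ₁ hT₁⟩
    have hτ₂I : τ₂ ∈ Ioo (-((2 * L) ^ 2)) 0 :=
      ⟨by linarith [neg_abs_le τ₂, abs_nonneg τ₁, norm_nonneg δ], lt_of_lt_of_le hτ₂ hT₁⟩
    have hA₁ := Backward.lintegral_ball_le_of_gaugeA h2L (hA (2 * L) h2L) hτ₁I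
    have hA₂ := Backward.lintegral_ball_le_of_gaugeA h2L (hA (2 * L) h2L) hτ₂I
    -- the translated slice on `B_L` sits in `B_{2L}`
    have hδL : ‖δ‖ ≤ L := by linarith [norm_nonneg δ, abs_nonneg τ₁, abs_nonneg τ₂]
    have htr : ∫⁻ y in ball (0 : EuclideanSpace ℝ (Fin 3)) L, ‖u τ₁ (y + δ)‖ₑ ^ 2 ≤
        ∫⁻ y in ball (0 : EuclideanSpace ℝ (Fin 3)) (2 * L), ‖u τ₁ y‖ₑ ^ 2 :=
      setLIntegral_ball_translate_le (fun y => ‖u τ₁ y‖ₑ ^ 2) hδL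
    calc ∫⁻ y in ball (0 : EuclideanSpace ℝ (Fin 3)) L, ‖(fun _ : EuclideanSpace ℝ (Fin 3) => w) y‖ₑ ^ 2
        = ∫⁻ y in ball (0 : EuclideanSpace ℝ (Fin 3)) L, ‖u τ₂ y - u τ₁ (y + δ)‖ₑ ^ 2 := by
          refine lintegral_congr_ae (Eventually.of_forall fun y => ?_); simp only [← hwy y]
      _ ≤ ∫⁻ y in ball (0 : EuclideanSpace ℝ (Fin 3)) L, (2 * ‖u τ₂ y‖ₑ ^ 2 + 2 * ‖u τ₁ (y + δ)‖ₑ ^ 2) :=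
          lintegral_mono fun y => TypeITraceScarL3.enorm_sub_sq_le _ _
      _ = (2 * ∫⁻ y in ball (0 : EuclideanSpace ℝ (Fin 3)) L, ‖u τ₂ y‖ₑ ^ 2) +
            2 * ∫⁻ y in ball (0 : EuclideanSpace ℝ (Fin 3)) L, ‖u τ₁ (y + δ)‖ₑ ^ 2 := by
          rw [lintegral_add_right' _ ((hm₁.restrict.enorm.pow_const 2).const_mul 2), lintegral_const_mul'' _ (hm₁.restrict.enorm.pow_const 2),
            lintegral_const_mul'' _ ((aestronglyMeasurable_slice hH hT₁ hu hτ₂).restrict.enorm.pow_const 2)]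
      _ ≤ (2 * ENNReal.ofReal ((c : ℝ) * (2 * L) ^ (1 - 2 * ρ))) + 2 * ENNReal.ofReal ((c : ℝ) * (2 * L) ^ (1 - 2 * ρ)) :=
          add_le_add (mul_le_mul' le_rfl ((lintegral_mono_set (ball_subset_ball (by linarith))).trans hA₂))
            (mul_le_mul' le_rfl (htr.trans hA₁))
      _ ≤ (32 * (c : ℝ≥0∞)) * ENNReal.ofReal (L ^ (1 - 2 * ρ)) := by
          -- `(2L)^{1−2ρ} = 2^{1−2ρ} L^{1−2ρ} ≤ 8 L^{1−2ρ}` (`ρ > −1`)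
          have h2 : (2 : ℝ) ^ (1 - 2 * ρ) ≤ 2 ^ (3 : ℝ) := Real.rpow_le_rpow_of_exponent_le one_le_two (by linarith)
          have h3 : (c : ℝ) * (2 * L) ^ (1 - 2 * ρ) ≤ (c : ℝ) * (8 * L ^ (1 - 2 * ρ)) := by
            refine mul_le_mul_of_nonneg_left ?_ c.coe_nonneg
            rw [Real.mul_rpow zero_le_two hL0.le]
            have : (2 : ℝ) ^ (3 : ℝ) = 8 := by norm_num
            nlinarith [Real.rpow_nonneg hL0.le (1 - 2 * ρ)]
          have h4 : ENNReal.ofReal ((c : ℝ) * (8 * L ^ (1 - 2 * ρ))) = 8 * (c : ℝ≥0∞) * ENNReal.ofReal (L ^ (1 - 2 * ρ)) := by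
            rw [ENNReal.ofReal_mul c.coe_nonneg, ENNReal.ofReal_mul (by norm_num), ENNReal.ofReal_ofNat, ENNReal.ofReal_coe_nnreal]; ring
          calc (2 * ENNReal.ofReal ((c : ℝ) * (2 * L) ^ (1 - 2 * ρ))) + 2 * ENNReal.ofReal ((c : ℝ) * (2 * L) ^ (1 - 2 * ρ))
              = 4 * ENNReal.ofReal ((c : ℝ) * (2 * L) ^ (1 - 2 * ρ)) := by rw [← two_mul, ← mul_assoc]; norm_num
            _ ≤ 4 * ENNReal.ofReal ((c : ℝ) * (8 * L ^ (1 - 2 * ρ))) := mul_le_mul' le_rfl (ENNReal.ofReal_le_ofReal h3)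
            _ = (32 * (c : ℝ≥0∞)) * ENNReal.ofReal (L ^ (1 - 2 * ρ)) := by rw [h4]; ring
  obtain ⟨C, hC, hCgrow⟩ := Shifted.growth_of_growth_le (V := fun _ : EuclideanSpace ℝ (Fin 3) => w) continuous_const
    (by linarith : 1 - 2 * ρ ≤ 3) hL₀1 (ENNReal.mul_ne_top ENNReal.ofNat_ne_top ENNReal.coe_ne_top) hgrow
  have hw0 : w = 0 := NoDrift.eq_zero_of_const_of_lintegral_ball_le hC (by linarith) hCgrow
  rw [hw] at hw0
  exact (sub_eq_zero.1 hw0).symm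

/-- **A frame-steady past member is ONE measurable profile carried along the frame, with NO background**: `u(τ) = Ũ(· − ξ(τ))` for all `τ < T₁`,
`Ũ = U + η(T₁ − 1)` a.e.-strongly measurable (`ρ > −1`). [folklore] -/
theorem exists_profile_noBackground
    (hH : HasWeakSpatialGradientOn (slab (EuclideanSpace ℝ (Fin 3)) (Iio 0) isOpen_Iio) u H) (hT₁ : T₁ ≤ 0)
    (hu : ∀ τ : ℝ, τ < T₁ → u τ = fun y => U (y - ξ τ) + η τ)
    {ρ : ℝ} (hρ : -1 < ρ) {c : ℝ≥0}
    (hA : ∀ a : ℝ, 0 < a → ENNReal.ofReal (a ^ (2 * ρ)) * cknA a (0 : ℝ × EuclideanSpace ℝ (Fin 3)) u ≤ (c : ℝ≥0∞)) :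
    ∃ U' : EuclideanSpace ℝ (Fin 3) → EuclideanSpace ℝ (Fin 3), AEStronglyMeasurable U' volume ∧
      ∀ τ : ℝ, τ < T₁ → u τ = fun y => U' (y - ξ τ) := by
  refine ⟨fun y => U y + η (T₁ - 1), (aestronglyMeasurable_profile hH hT₁ hu).add aestronglyMeasurable_const, fun τ hτ => ?_⟩
  rw [hu τ hτ, background_eq_of_gaugeA hH hT₁ hu hρ hA hτ (by linarith : T₁ - 1 < T₁)]

end FrameSteady

end Summit.NavierStokesRegularity.NavierStokesRegularity.Theorems.PowerGaugeEulerLiouville
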